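import Summits.BirchSwinnertonDyer.Rank1Residual.X11b.AnticyclotomicControlSplitImprimitive
import Summits.BirchSwinnertonDyer.Rank1Residual.X11b.AnticyclotomicTorsionCriterion
import HarnessLib

/-!
# X11b, route R1 — `Σ`-monotonicity of the `Γ`-invariants and the TORSION clause of the `Σ = ∅`
# module `X_ac(E[p^∞])` from the finiteness of `Sel_𝔭^Σ(K, E[p^∞])` for `Σ ⊇ {w ∣ N⁺}`

HONEST FRAMING (cell `b2b-bsdres`, run/shared/lean/b2b/bsd-rank1-residual/, verbatim in every
file): the goal of the cell is to DELETE the COMBINATION-SHAPED residual classes of the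
Birch–Swinnerton-Dyer formula for ALL analytic-rank `≤ 1` elliptic curves over `ℚ` — "full BSD
formula for every rank `≤ 1` curve in class `C`" assembled STRICTLY from published theorems — so
that the rank-`≤ 1` remainder becomes exactly the CONSTRUCTION-SHAPED classes, which are TYPED
(missing-input `Prop`s), NOT attempted. This is not "finishing BSD". Sub-cell
`b2b-bsdres-multr1-p1` (X11b, route R1 = Castella 2018 Thm. A re-proved along the author's
erratum); a RESEARCH ROUTE; no claim beyond the stated class; X11b stays CONSTRUCTION-SHAPED;
nothing here changes a label; no named fact is minted (proved theorems only; no `sorry`).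

## Why this file

The typed control input `R1ControlOnTreeAt` and the open input `R1OpenInputOnTreeAt` of route R1 speak
about the `Σ = ∅` module `X_ac(E[p^∞]) = X_ac^∅`, whose TORSION clause (Cas18 Thm. 2.3 / erratum
Thm. 1.1, first clause) gen 9 reduced to the finiteness of `H⁰(Γ, Sel_𝔭(K_∞, E[p^∞]))`
(`XAc.module_finite_and_isTorsion_of_finite_invariants`). This gen's control theorems are for
`Σ ⊇ {w ∣ N⁺}` (`AnticyclotomicControlSplitImprimitive`: `s^Σ` bijective). The bridge is monotonicity
in `Σ`: `Sel_𝔭^∅ ≤ Sel_𝔭^Σ` compatibly with `conj_γ`, so `H⁰(Γ, Sel_𝔭^∅) ↪ H⁰(Γ, Sel_𝔭^Σ) ≅ Sel_𝔭^Σ(K)`.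
Hence:

* `finite_endInvariants_of_subset` — `Σ ⊆ Σ'` and `Sel_𝔭^{Σ'}(K_∞)^γ` finite ⟹ `Sel_𝔭^Σ(K_∞)^γ` finite;
* `XAc.module_finite_and_isTorsion_of_subset` — `s^{Σ'}` bijective and `Sel_𝔭^{Σ'}(K, E[p^∞])` finite
  ⟹ `X_ac^Σ(E[p^∞])` is finitely generated and `Λ`-TORSION for EVERY `Σ ⊆ Σ'` (in particular `Σ = ∅`);
* **`IsAnticyclotomic.isTorsion_XAc_of_finite_selmerAcBase`** — `K` imaginary quadratic, `κ`
  anticyclotomic, `Σ' ⊇ {bad v ∤ p over split primes}`: `Sel_𝔭^{Σ'}(K, E[p^∞])` finite ⟹ `X_ac^Σ`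
  torsion for every `Σ ⊆ Σ'`; route R1: **`ChainLocus.isTorsion_XAc_empty_of_finite_selmerAcBase`** —
  on `ChainLocus`, the torsion clause for THE module `X_ac(E[p^∞])` of `R1ControlOnTreeAt` follows from
  the finiteness of Castella's `N⁺`-imprimitive Selmer group OVER `K`.

What remains typed (unchanged): that finiteness itself (JSW §3.3.5: `rank E(K) = 1`, `Ш(E/K)[p^∞]`
finite, `log_ω P ≠ 0` ⟹ `Sel_𝔭(K, E[p^∞])` finite — Poitou–Tate), the Tamagawa passage `Σ → ∅` for
the ORDER, `Sel_Γ = 0`, and the OPEN input (IMC∘BDP)@𝟙. No label changes.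

References: [Castella2018] Def. 2.2, Thm. 2.3 (arXiv:1704.06608 p. 5); [Castella2018Erratum] Thm. 1.1
(p. 1); [JetchevSkinnerWan2017] §3.3.5 (shape only); [GreenbergLNM1716] §1 p. 60, §3 pp. 85–90.
-/

noncomputable section

open scoped Classical

open NumberField IsDedekindDomain Field
open Literature.NumberTheory.EllipticCurves Literature.NumberTheory.EllipticCurves.GreenbergSelmer
open Literature.NumberTheory.GaloisRepresentations IsDedekindDomain.HeightOneSpectrum

universe u

namespace Summit.BirchSwinnertonDyer.Rank1Residual.X11b.AcSelmer

/-! ## `Σ ⊆ Σ'`: `Sel_𝔭^Σ(K_∞)^γ ↪ Sel_𝔭^{Σ'}(K_∞)^γ` -/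

section Monotone

variable {K : Type u} [Field K] [NumberField K] (W : WeierstrassCurve K) (p : ℕ) [Fact p.Prime]
  (κ : ZpExtension K p) (𝔭 : HeightOneSpectrum (𝓞 K)) {S S' : Set (HeightOneSpectrum (𝓞 K))}
  (γ : absoluteGaloisGroup K)

/-- **`Σ ⊆ Σ'` ⟹ `H⁰(⟨γ⟩, Sel_𝔭^Σ(K_∞, E[p^∞]))` embeds in `H⁰(⟨γ⟩, Sel_𝔭^{Σ'}(K_∞, E[p^∞]))`**: the
inclusion `Sel_𝔭^Σ ≤ Sel_𝔭^{Σ'}` (`selmerOver_mono`) commutes with `conj_γ`, so it maps `γ`-invariants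
to `γ`-invariants injectively; in particular finiteness descends from `Σ'` to `Σ`.
[cite: Castella2018, Def. 2.2 (arXiv:1704.06608 p. 5), "`Σ`-imprimitive"] -/
theorem finite_endInvariants_of_subset (h : S ⊆ S')
    (hfin : Finite (IwasawaDual.endInvariants (conjSelmerAc W p κ 𝔭 S' γ - 1))) :
    Finite (IwasawaDual.endInvariants (conjSelmerAc W p κ 𝔭 S γ - 1)) := by
  -- images in the common ambient group `H¹(K_∞, E[p^∞])`
  set A' : Set (W.subgroupH1 p κ.kerSubgroup) :=
    (fun s : selmerAc W p κ 𝔭 S' ↦ (s : W.subgroupH1 p κ.kerSubgroup)) ''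
      (IwasawaDual.endInvariants (conjSelmerAc W p κ 𝔭 S' γ - 1) : Set (selmerAc W p κ 𝔭 S'))
    with hA'
  have hA'fin : A'.Finite := (Set.toFinite _).image _
  set A : Set (W.subgroupH1 p κ.kerSubgroup) :=
    (fun s : selmerAc W p κ 𝔭 S ↦ (s : W.subgroupH1 p κ.kerSubgroup)) ''
      (IwasawaDual.endInvariants (conjSelmerAc W p κ 𝔭 S γ - 1) : Set (selmerAc W p κ 𝔭 S))
    with hA
  have hsub : A ⊆ A' := by
    rintro _ ⟨s, hs, rfl⟩
    have hs1 : conjSelmerAc W p κ 𝔭 S γ s = s := by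
      have := (IwasawaDual.mem_endInvariants_iff _ _).mp hs
      rwa [IwasawaDual.End_sub_apply, AddMonoid.End.one_apply, sub_eq_zero] at this
    have hs2 : W.conjH1 p κ.kerSubgroup γ (s : W.subgroupH1 p κ.kerSubgroup) = s := by
      rw [← coe_conjSelmerAc_apply, hs1]
    refine ⟨⟨(s : W.subgroupH1 p κ.kerSubgroup), selmerOver_mono h s.2⟩, ?_, rfl⟩
    change (⟨(s : W.subgroupH1 p κ.kerSubgroup), selmerOver_mono h s.2⟩ : selmerAc W p κ 𝔭 S') ∈
      IwasawaDual.endInvariants (conjSelmerAc W p κ 𝔭 S' γ - 1)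
    rw [IwasawaDual.mem_endInvariants_iff, IwasawaDual.End_sub_apply, AddMonoid.End.one_apply,
      sub_eq_zero]
    exact Subtype.ext hs2
  have hAfin : A.Finite := hA'fin.subset hsub
  have hTfin : (IwasawaDual.endInvariants (conjSelmerAc W p κ 𝔭 S γ - 1) :
      Set (selmerAc W p κ 𝔭 S)).Finite :=
    Set.Finite.of_finite_image hAfin Subtype.val_injective.injOn
  exact hTfin.to_subtype

variable [hγ : Fact (κ.IsTopGenerator γ)]

/-- **`s^{Σ'}` bijective and `Sel_𝔭^{Σ'}(K, E[p^∞])` finite ⟹ `X_ac^Σ(E[p^∞])` finitely generated and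
`Λ`-TORSION for every `Σ ⊆ Σ'`** (Greenberg's criterion `XAc.module_finite_and_isTorsion_of_finite_invariants`
at `Σ`, the finiteness transported along `Sel_𝔭^Σ(K_∞)^γ ↪ Sel_𝔭^{Σ'}(K_∞)^γ ≅ Sel_𝔭^{Σ'}(K)`).
[cite: GreenbergLNM1716, §1 p. 60 (after Conj. 1.3)] [cite: JetchevSkinnerWan2017, §3.3 (arXiv:1512.06894 §3.3.5) (shape only)] -/
theorem XAc.module_finite_and_isTorsion_of_subset (h : S ⊆ S')
    (hbij : Function.Bijective (controlMap W p κ 𝔭 S' γ)) (hfin : Finite (selmerAcBase W p 𝔭 S')) :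
    Module.Finite (IwasawaAlgebra p) (XAc W p κ 𝔭 S γ) ∧
      Module.IsTorsion (IwasawaAlgebra p) (XAc W p κ 𝔭 S γ) :=
  XAc.module_finite_and_isTorsion_of_finite_invariants W p κ 𝔭 S γ
    (finite_endInvariants_of_subset W p κ 𝔭 γ h
      ((finite_selmerAcBase_iff_of_bijective W p κ 𝔭 S' γ hbij).mp hfin))

end Monotone

/-! ## Imaginary quadratic `K`, anticyclotomic `κ` -/

section Quadratic

variable {K : Type} [Field K] [NumberField K] (E : WeierstrassCurve K) [E.IsElliptic]
  (p : ℕ) [Fact p.Prime] (κ : ZpExtension K p) (𝔭 : HeightOneSpectrum (𝓞 K))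
  {S S' : Set (HeightOneSpectrum (𝓞 K))} (γ : absoluteGaloisGroup K) [hγ : Fact (κ.IsTopGenerator γ)]

/-- **The torsion clause from finiteness over `K`.** For `K` imaginary quadratic, `κ` anticyclotomic
with topological generator `γ`, `𝔭` with `E(K̄)[p^∞]^{D_𝔭 ⊓ ker κ} = 0`, `H¹(K, E[p^∞]) ↪ H¹(K_∞, E[p^∞])`,
and `Σ' ⊇ {v ∤ p : E bad at v, v over a split prime}`: if `Sel_𝔭^{Σ'}(K, E[p^∞])` is finite then
`X_ac^Σ(E[p^∞])` is finitely generated `Λ`-torsion for EVERY `Σ ⊆ Σ'` — in particular for `Σ = ∅`.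
[cite: Castella2018, Thm. 2.3 (arXiv:1704.06608 p. 5), first clause (shape only)] [cite: GreenbergLNM1716, §1 p. 60] -/
theorem IsAnticyclotomic.isTorsion_XAc_of_finite_selmerAcBase [IsTotallyComplex K]
    (hK : Module.finrank ℚ K = 2) (hκ : κ.IsAnticyclotomic) (h : S ⊆ S')
    (hinj : Function.Injective (ResKernel.resSubgroup κ.kerSubgroup (E.geomPrimaryTorsion p)))
    (h0 : FixedPoints.addSubgroup ↥(decomp 𝔭 ⊓ κ.kerSubgroup) (E.geomPrimaryTorsion p) = ⊥)
    (hS : ∀ v : HeightOneSpectrum (𝓞 K), (p : 𝓞 K) ∉ v.asIdeal → ¬ E.HasGoodReductionAt v →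
      v.asIdeal.ramificationIdx (𝓞 ℚ) = 1 → v.asIdeal.inertiaDeg (𝓞 ℚ) = 1 → v ∈ S')
    (hfin : Finite (selmerAcBase E p 𝔭 S')) :
    Module.Finite (IwasawaAlgebra p) (XAc E p κ 𝔭 S γ) ∧
      Module.IsTorsion (IwasawaAlgebra p) (XAc E p κ 𝔭 S γ) :=
  XAc.module_finite_and_isTorsion_of_subset E p κ 𝔭 γ h
    (IsAnticyclotomic.controlMap_bijective_of_splitBad_subset E p κ 𝔭 S' hK hκ hγ.out hinj h0 hS) hfin

end Quadratic

end Summit.BirchSwinnertonDyer.Rank1Residual.X11b.AcSelmer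

/-! ## Route R1: the torsion clause of THE module `X_ac(E[p^∞])` (`Σ = ∅`) -/

namespace Summit.BirchSwinnertonDyer.Rank1Residual.X11b

section RouteR1

open AcSelmer Literature.NumberTheory.EllipticCurves.Rank1Residual

variable {W : WeierstrassCurve ℚ} [W.IsElliptic] [W.IsGloballyMinimal] {p : ℕ} [Fact p.Prime]

/-- **Route R1: the TORSION clause of Cas18 Thm. 2.3 / erratum Thm. 1.1 for the constructed
`X_ac(E[p^∞]) = X_ac^∅` follows from the finiteness of the `N⁺`-imprimitive Selmer group OVER `K`.** On
`ChainLocus`, for every imaginary quadratic `K`, every degree-one `𝔭 ∣ p`, every anticyclotomic `κ`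
with topological generator `γ`, and any `Σ' ⊇ {v ∤ p : ℓ_v ∣ N_E, e = f = 1}`: if
`Sel_𝔭^{Σ'}(K, E[p^∞])` is finite, then `X_ac^Σ(E[p^∞])` is finitely generated `Λ`-torsion for every
`Σ ⊆ Σ'`, in particular the `Σ = ∅` module of `R1ControlOnTreeAt` / `R1OpenInputOnTreeAt`
(`XAc.HasCharValuationAt`'s torsion conjunct). The finiteness over `K` is NOT proved here (JSW §3.3.5).
[cite: Castella2018, Thm. 2.3 (arXiv:1704.06608 p. 5), first clause (shape only)] [cite: Castella2018Erratum, Thm. 1.1 (p. 1), first clause (shape only)] [cite: JetchevSkinnerWan2017, §3.3.5 (shape only)] -/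
theorem ChainLocus.isTorsion_XAc_of_finite_selmerAcBase (h : ChainLocus W p)
    (K : Type) [Field K] [NumberField K] (hK : IsImaginaryQuadratic K) {κ : ZpExtension K p}
    (hκ : κ.IsAnticyclotomic) (γ : absoluteGaloisGroup K) [hγ : Fact (κ.IsTopGenerator γ)]
    (𝔭 : HeightOneSpectrum (𝓞 K)) (h𝔭 : ((p : ℕ) : 𝓞 K) ∈ 𝔭.asIdeal)
    (he : 𝔭.asIdeal.ramificationIdx (𝓞 ℚ) = 1) (hf : 𝔭.asIdeal.inertiaDeg (𝓞 ℚ) = 1)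
    {S S' : Set (HeightOneSpectrum (𝓞 K))} (hSS' : S ⊆ S')
    (hS : ∀ v : HeightOneSpectrum (𝓞 K), (p : 𝓞 K) ∉ v.asIdeal →
      (Rat.HeightOneSpectrum.primesEquiv (v.under (𝓞 ℚ)) : ℕ) ∣ W.conductorNorm ℤ →
      v.asIdeal.ramificationIdx (𝓞 ℚ) = 1 → v.asIdeal.inertiaDeg (𝓞 ℚ) = 1 → v ∈ S')
    (hfin : Finite (selmerAcBase (W.baseChange K) p 𝔭 S')) :
    Module.Finite (IwasawaAlgebra p) (XAc (W.baseChange K) p κ 𝔭 S γ) ∧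
      Module.IsTorsion (IwasawaAlgebra p) (XAc (W.baseChange K) p κ 𝔭 S γ) :=
  XAc.module_finite_and_isTorsion_of_subset (W.baseChange K) p κ 𝔭 γ hSS'
    (h.controlMap_bijective_of_conductor_split_subset K hK hκ hγ.out 𝔭 h𝔭 he hf S' hS) hfin

/-- The `Σ = ∅` instance: **`Sel_𝔭^{Σ'}(K, E[p^∞])` finite for some `Σ' ⊇ {w ∣ N⁺}` ⟹ `X_ac(E[p^∞])` is
`Λ`-torsion** on `ChainLocus` (the torsion conjunct of the typed inputs' `HasCharValuationAt`).
[cite: Castella2018, Thm. 2.3 (arXiv:1704.06608 p. 5), first clause (shape only)] [cite: Castella2018Erratum, Thm. 1.1 (p. 1), first clause (shape only)] -/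
theorem ChainLocus.isTorsion_XAc_empty_of_finite_selmerAcBase (h : ChainLocus W p)
    (K : Type) [Field K] [NumberField K] (hK : IsImaginaryQuadratic K) {κ : ZpExtension K p}
    (hκ : κ.IsAnticyclotomic) (γ : absoluteGaloisGroup K) [hγ : Fact (κ.IsTopGenerator γ)]
    (𝔭 : HeightOneSpectrum (𝓞 K)) (h𝔭 : ((p : ℕ) : 𝓞 K) ∈ 𝔭.asIdeal)
    (he : 𝔭.asIdeal.ramificationIdx (𝓞 ℚ) = 1) (hf : 𝔭.asIdeal.inertiaDeg (𝓞 ℚ) = 1)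
    {S' : Set (HeightOneSpectrum (𝓞 K))}
    (hS : ∀ v : HeightOneSpectrum (𝓞 K), (p : 𝓞 K) ∉ v.asIdeal →
      (Rat.HeightOneSpectrum.primesEquiv (v.under (𝓞 ℚ)) : ℕ) ∣ W.conductorNorm ℤ →
      v.asIdeal.ramificationIdx (𝓞 ℚ) = 1 → v.asIdeal.inertiaDeg (𝓞 ℚ) = 1 → v ∈ S')
    (hfin : Finite (selmerAcBase (W.baseChange K) p 𝔭 S')) :
    Module.IsTorsion (IwasawaAlgebra p) (XAc (W.baseChange K) p κ 𝔭 ∅ γ) :=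
  (h.isTorsion_XAc_of_finite_selmerAcBase K hK hκ γ 𝔭 h𝔭 he hf (Set.empty_subset S') hS hfin).2

end RouteR1

end Summit.BirchSwinnertonDyer.Rank1Residual.X11b

end
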